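import Mathlib

/-!
# Venture HSemireg — MOD-4 OFF THE SPLIT FAMILY: the square-root form `M_f = (−1)ⁿ · T_f²` of the middle-degree matrix
# of THEOREM R_f and the spectral symmetry of `T_f` for odd `n` (corollary (C8); seat `w3-mod4-1` g4, files of record
# `widen/W3/MOD4-OFFSPLIT-w3mod4.md` v1.5.1 §10.2, `widen/W3/MOD4-OFFSPLIT-THEOREMS-w3mod4.md` v1.4.7)

HONEST FRAMING. Lean index of the computation cell `pub-hsemireg`, widening seat `w3-mod4-1`.  POLYNOMIAL IDENTITIES
BETWEEN EXPLICIT `(n+1) × (n+1)` MATRICES over an arbitrary commutative ring, nothing else: no abelian variety, no sheaf,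
no Ext group, no semiregularity map.  On paper (THEOREM R_f) the middle-degree contraction rank of a class-exact Mukai
vector `f(h) + w` on a Weil `2n`-fold is `(r_n + 2)·C(2n,n) − 2 r_n − dim ker (M_f − (−1)ⁿ τ)` with
`(M_f)_{ab} = (−1)^{n+b} C(n,b) Σ_m (−1)^m C(n,m) q_{n−a+m} q_{n−m+b}` (`q_i` the coefficients of `f` in `hⁱ/i!`).
Corollary (C8): `M_f = (−1)ⁿ · T_f²` with `(T_f)_{ab} = (−1)^b C(n,b) q_{n−a+b}`, i.e. `T_f = J·H·S·D` (`H_{ab} = q_{a+b}`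
the middle Hankel matrix, `J` the antidiagonal unit, `S = diag (−1)^i`, `D = diag C(n,i)`), so the middle-degree loci are
the squares of the eigenvalues of `T_f`; and for ODD `n` the characteristic polynomials of `T_f` and `−T_f` coincide
(`J T_f J = −H J S D`, whose characteristic polynomial is that of `T_f` by transposition and cyclicity), so every locus
carries both eigenvalues `±μ` («on a Weil (4m+2)-fold the middle degree never drops by exactly one»).  This file proves
the identity and the symmetry for an arbitrary coefficient sequence `q : ℕ → R`.  Companion of `Mod4TwoSlopeSpectrum.lean`.
Nothing here says that HC, HC_CM or HC_AV holds.

CONTENT (all PROVED, 0 sorry), namespace `Summit.Ventures.HSemireg.Mod4`: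
* `hankelT n q`, `middleM n q` — `T_f`, `M_f`;  `middleM_eq_smul_hankelT_sq` — `M_f = (−1)ⁿ • T_f²`;
* `revJ`, `signS`, `binomD`, `hankelH` — `J`, `S`, `D`, `H`;  `hankelT_eq_mul` — `T_f = J * H * S * D`;
* `charpoly_neg_hankelT` — for odd `n`, `(−T_f).charpoly = T_f.charpoly`.
-/

namespace Summit.Ventures.HSemireg

namespace Mod4

open Finset Matrix

variable {R : Type*} [CommRing R]

/-- `T_f`: entry `(a,b)` is `(−1)^b · C(n,b) · q_{n−a+b}`. -/
def hankelT (n : ℕ) (q : ℕ → R) : Matrix (Fin (n + 1)) (Fin (n + 1)) R :=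
  fun a b => (-1 : R) ^ (b : ℕ) * (n.choose (b : ℕ) : R) * q (n - (a : ℕ) + (b : ℕ))

/-- `M_f`: entry `(a,b)` is `(−1)^{n+b} · C(n,b) · Σ_m (−1)^m C(n,m) · q_{n−a+m} · q_{n−m+b}`. -/
def middleM (n : ℕ) (q : ℕ → R) : Matrix (Fin (n + 1)) (Fin (n + 1)) R :=
  fun a b => (-1 : R) ^ (n + (b : ℕ)) * (n.choose (b : ℕ) : R) *
    ∑ m : Fin (n + 1), (-1 : R) ^ (m : ℕ) * (n.choose (m : ℕ) : R) * q (n - (a : ℕ) + (m : ℕ)) * q (n - (m : ℕ) + (b : ℕ))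

/-- **(C8), square-root form:** `M_f = (−1)ⁿ · T_f²`. -/
theorem middleM_eq_smul_hankelT_sq (n : ℕ) (q : ℕ → R) :
    middleM n q = (-1 : R) ^ n • (hankelT n q * hankelT n q) := by
  ext a b
  simp only [middleM, hankelT, Matrix.smul_apply, Matrix.mul_apply, smul_eq_mul, Finset.mul_sum]
  refine Finset.sum_congr rfl fun m _ => ?_
  rw [pow_add]
  ring

/-- The antidiagonal unit `J`: `J_{ab} = [b = rev a]`. -/
def revJ (n : ℕ) : Matrix (Fin (n + 1)) (Fin (n + 1)) R := fun a b => if b = a.rev then 1 else 0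

/-- `S = diag (−1)^i`. -/
def signS (n : ℕ) : Matrix (Fin (n + 1)) (Fin (n + 1)) R := diagonal fun i => (-1 : R) ^ (i : ℕ)

/-- `D = diag C(n,i)`. -/
def binomD (n : ℕ) : Matrix (Fin (n + 1)) (Fin (n + 1)) R := diagonal fun i => (n.choose (i : ℕ) : R)

/-- The middle Hankel matrix `H_{ab} = q_{a+b}`. -/
def hankelH (n : ℕ) (q : ℕ → R) : Matrix (Fin (n + 1)) (Fin (n + 1)) R := fun a b => q ((a : ℕ) + (b : ℕ))

/-- Left multiplication by `J` reverses the row index: `(J A)_{ab} = A_{rev a, b}`. -/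
theorem revJ_mul_apply (n : ℕ) (A : Matrix (Fin (n + 1)) (Fin (n + 1)) R) (a b : Fin (n + 1)) :
    ((revJ n : Matrix (Fin (n + 1)) (Fin (n + 1)) R) * A) a b = A a.rev b := by
  simp only [Matrix.mul_apply, revJ]
  rw [Finset.sum_eq_single a.rev]
  · simp
  · intro c _ hc; simp [hc]
  · intro h; exact absurd (Finset.mem_univ _) h

/-- Right multiplication by `J` reverses the column index: `(A J)_{ab} = A_{a, rev b}`. -/
theorem mul_revJ_apply (n : ℕ) (A : Matrix (Fin (n + 1)) (Fin (n + 1)) R) (a b : Fin (n + 1)) :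
    (A * (revJ n : Matrix (Fin (n + 1)) (Fin (n + 1)) R)) a b = A a b.rev := by
  simp only [Matrix.mul_apply, revJ]
  rw [Finset.sum_eq_single b.rev]
  · simp [Fin.rev_rev]
  · intro c _ hc
    have : b ≠ c.rev := fun h => hc (by rw [h, Fin.rev_rev])
    simp [this]
  · intro h; exact absurd (Finset.mem_univ _) h

/-- `J` is an involution: `J J = 1`. -/
theorem revJ_mul_revJ (n : ℕ) : (revJ n : Matrix _ _ R) * revJ n = 1 := by
  ext a b
  rw [revJ_mul_apply]
  simp only [revJ, Matrix.one_apply, Fin.rev_rev]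
  by_cases h : a = b
  · subst h; simp
  · rw [if_neg (fun e => h e.symm), if_neg h]

/-- `rev a = n − a` as natural numbers, for `a : Fin (n+1)`. -/
theorem val_rev' {n : ℕ} (a : Fin (n + 1)) : ((a.rev : Fin (n + 1)) : ℕ) = n - (a : ℕ) := by
  rw [Fin.val_rev]; omega

/-- `T_f = J·H·S·D`. -/
theorem hankelT_eq_mul (n : ℕ) (q : ℕ → R) :
    hankelT n q = revJ n * hankelH n q * signS n * binomD n := by
  ext a b
  rw [signS, binomD, Matrix.mul_diagonal, Matrix.mul_diagonal, revJ_mul_apply, hankelH, hankelT, val_rev']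
  ring

/-- `D J = J D` (the binomial diagonal is palindromic: `C(n, n−a) = C(n, a)`). -/
theorem binomD_mul_revJ (n : ℕ) : (binomD n : Matrix _ _ R) * revJ n = revJ n * binomD n := by
  ext a b
  rw [mul_revJ_apply, revJ_mul_apply, binomD, diagonal_apply, diagonal_apply]
  by_cases h : a = b.rev
  · subst h
    simp only [Fin.rev_rev, if_true]
    rw [val_rev']
    have hb : (b : ℕ) ≤ n := Nat.lt_succ_iff.mp b.isLt
    rw [Nat.choose_symm hb]
  · have h' : ¬ (a.rev = b) := fun e => h (by rw [← e, Fin.rev_rev])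
    simp [h, h']

/-- The two diagonal matrices commute: `S D = D S`. -/
theorem signS_mul_binomD (n : ℕ) : (signS n : Matrix _ _ R) * binomD n = binomD n * signS n := by
  simp only [signS, binomD, diagonal_mul_diagonal]
  congr 1; funext i; ring

/-- For odd `n`, `S J = −J S` (since `(−1)^{n−a} = −(−1)^a`). -/
theorem signS_mul_revJ_of_odd {n : ℕ} (hn : Odd n) :
    (signS n : Matrix _ _ R) * revJ n = -(revJ n * signS n) := by
  ext a b
  rw [Matrix.neg_apply, mul_revJ_apply, revJ_mul_apply, signS, diagonal_apply, diagonal_apply]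
  by_cases h : a = b.rev
  · subst h
    simp only [Fin.rev_rev, if_true]
    rw [val_rev']
    have hb : (b : ℕ) ≤ n := Nat.lt_succ_iff.mp b.isLt
    have : (-1 : R) ^ (n - (b : ℕ)) * (-1 : R) ^ (b : ℕ) = -1 := by
      rw [← pow_add, Nat.sub_add_cancel hb, hn.neg_one_pow]
    calc (-1 : R) ^ (n - (b : ℕ)) = (-1 : R) ^ (n - (b : ℕ)) * ((-1 : R) ^ (b : ℕ) * (-1 : R) ^ (b : ℕ)) := by
            rw [← pow_add, ← two_mul, pow_mul]; simp
      _ = ((-1 : R) ^ (n - (b : ℕ)) * (-1 : R) ^ (b : ℕ)) * (-1 : R) ^ (b : ℕ) := by ring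
      _ = -(-1 : R) ^ (b : ℕ) := by rw [this]; ring
  · have h' : ¬ (a.rev = b) := fun e => h (by rw [← e, Fin.rev_rev])
    simp [h, h']

/-- `J` is symmetric. -/
theorem revJ_transpose (n : ℕ) : (revJ n : Matrix _ _ R)ᵀ = revJ n := by
  ext a b
  simp only [Matrix.transpose_apply, revJ]
  have : (a = b.rev) ↔ (b = a.rev) := by
    constructor <;> intro h <;> rw [h, Fin.rev_rev]
  by_cases h : b = a.rev
  · rw [if_pos (this.mpr h), if_pos h]
  · rw [if_neg (fun e => h (this.mp e)), if_neg h]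

omit [CommRing R] in
/-- The Hankel matrix is symmetric. -/
theorem hankelH_transpose (n : ℕ) (q : ℕ → R) : (hankelH n q)ᵀ = hankelH n q := by
  ext a b; simp [hankelH, Matrix.transpose_apply, add_comm]

/-- Conjugation by the involution `J` does not change the characteristic polynomial. -/
theorem charpoly_revJ_conj (n : ℕ) (X : Matrix (Fin (n + 1)) (Fin (n + 1)) R) :
    (revJ n * X * revJ n).charpoly = X.charpoly := by
  rw [Matrix.charpoly_mul_comm, ← Matrix.mul_assoc, revJ_mul_revJ, Matrix.one_mul]

/-- **(C8), odd `n`:** the characteristic polynomials of `T_f` and `−T_f` coincide, so the spectrum of `T_f` is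
symmetric under `μ ↦ −μ` and every middle-degree locus `τ = μ²` carries both `±μ`. -/
theorem charpoly_neg_hankelT {n : ℕ} (hn : Odd n) (q : ℕ → R) :
    (-hankelT n q).charpoly = (hankelT n q).charpoly := by
  set J : Matrix (Fin (n + 1)) (Fin (n + 1)) R := revJ n with hJ
  set H : Matrix (Fin (n + 1)) (Fin (n + 1)) R := hankelH n q with hH
  set S : Matrix (Fin (n + 1)) (Fin (n + 1)) R := signS n with hS
  set D : Matrix (Fin (n + 1)) (Fin (n + 1)) R := binomD n with hD
  have hT : hankelT n q = J * H * S * D := hankelT_eq_mul n q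
  -- J T J = H S D J = H S J D = -(H J S D)
  have h1 : J * hankelT n q * J = -(H * J * S * D) := by
    rw [hT]
    calc J * (J * H * S * D) * J = (J * J) * H * S * (D * J) := by
            simp only [Matrix.mul_assoc]
      _ = H * S * (D * J) := by rw [hJ, revJ_mul_revJ, Matrix.one_mul]
      _ = H * S * (J * D) := by rw [hJ, hD, binomD_mul_revJ]
      _ = H * (S * J) * D := by simp only [Matrix.mul_assoc]
      _ = H * (-(J * S)) * D := by rw [hS, hJ, signS_mul_revJ_of_odd hn]
      _ = -(H * J * S * D) := by simp only [Matrix.mul_neg, Matrix.neg_mul, Matrix.mul_assoc]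
  -- charpoly (H J S D) = charpoly (T): transpose, then cyclicity
  have h2 : (H * J * S * D).charpoly = (hankelT n q).charpoly := by
    have ht : (H * J * S * D)ᵀ = D * S * J * H := by
      rw [Matrix.transpose_mul, Matrix.transpose_mul, Matrix.transpose_mul, hD, hS, hJ, hH, binomD, signS,
        diagonal_transpose, diagonal_transpose, revJ_transpose, hankelH_transpose]
      simp only [Matrix.mul_assoc]
    rw [← Matrix.charpoly_transpose, ht, hT]
    calc (D * S * J * H).charpoly = (H * (D * S * J)).charpoly := by
            rw [Matrix.charpoly_mul_comm]
      _ = (H * S * D * J).charpoly := by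
            rw [hD, hS, ← signS_mul_binomD]; simp only [Matrix.mul_assoc]
      _ = (J * (H * S * D)).charpoly := by rw [Matrix.charpoly_mul_comm]
      _ = (J * H * S * D).charpoly := by simp only [Matrix.mul_assoc]
  calc (-hankelT n q).charpoly = (J * (-hankelT n q) * J).charpoly := (charpoly_revJ_conj n _).symm
    _ = (-(J * hankelT n q * J)).charpoly := by rw [Matrix.mul_neg, Matrix.neg_mul]
    _ = (H * J * S * D).charpoly := by rw [h1, neg_neg]
    _ = (hankelT n q).charpoly := h2

end Mod4

end Summit.Ventures.HSemireg
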